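import Summits.RiemannHypothesis.RiemannHypothesis.Theorems.SoloInformedQuasiWeilGrowth

/-!
# Exponential slack in Weil's criterion, II: the criterion and the trivial floor

Solo programme `solo-RiemannHypothesis-informed`, session 2 — part of the exact-thermometer
package; the overview, the main theorem `width_iff_weilQuadratic_sobolev_subexp` and the
references are in `SoloInformedQuasiWeil.lean`. Everything here is proved (no named facts).

`RH ↔ ∀ κ > 0, ∃ C, ∀ a > 0, ε(a) ≥ -C e^{κ a}` for the ground energy `ε = weilGroundEnergy`
(`riemannHypothesis_iff_weilGroundEnergy_subexp`), the `Ω`-theorem from an off-line zero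
(`frequently_weilGroundEnergy_lt_of_offline_zero`), and the unconditional floor
`ε(a) ≥ -C (1 + a) e^{a}` (`weilGroundEnergy_ge_neg_exp`, the case `κ = 1⁺`).
-/

noncomputable section

open Complex Filter Set MeasureTheory
open scoped Real Topology ComplexConjugate ArithmeticFunction.vonMangoldt

namespace Summit.RiemannHypothesis.RiemannHypothesis.Theorems

open Literature.NumberTheory.LFunctions Literature.NumberTheory.LFunctions.WeilConverse

/-! ## The criterion in terms of Weil's functional and of the ground energy -/

/-- **Strip bound from quasi-positivity of Weil's functional**: if for all `a ≥ a₀` and all test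
`g` supported in `[-a, a]`, `Re W(g ⋆ g̃) ≥ -C e^{κ a} ‖g‖₂²` (`κ ≥ 0`), then every non-trivial
zero satisfies `|Re ρ - 1/2| ≤ κ/2` (`Q(g) = W(g ⋆ g̃)` by the explicit formula,
`combShapeDetection_zeroForm_eq_weilQuadratic`). [folklore] -/
theorem abs_re_sub_half_le_of_weilQuadratic_exp_lower {κ C a₀ : ℝ} (hκ : 0 ≤ κ)
    (H : ∀ a : ℝ, a₀ ≤ a → ∀ g : ℝ → ℂ, IsWeilTest g → tsupport g ⊆ Icc (-a) a →
      -(C * Real.exp (κ * a)) * ∫ t : ℝ, ‖g t‖ ^ 2 ≤ (weilQuadratic g).re)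
    {ρ : ℂ} (hρ : ρ ∈ ZetaZeros.riemannZetaNontrivialZeros) : |ρ.re - 1 / 2| ≤ κ / 2 :=
  abs_re_sub_half_le_of_zeroForm_exp_lower hκ
    (fun a ha g hg hs ↦ by rw [combShapeDetection_zeroForm_eq_weilQuadratic hg]; exact H a ha g hg hs) hρ

/-- A lower bound on the ground energy is a lower bound on the Rayleigh quotient:
`L ≤ ε(a)` gives `L ‖g‖₂² ≤ Re W(g ⋆ g̃)` for every test `g` supported in `[-a, a]`
(`weilGroundEnergy_le_div`; `g = 0` when `‖g‖₂ = 0`). [folklore] -/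
theorem mul_integral_le_weilQuadratic_of_le_weilGroundEnergy {a L : ℝ} (h : L ≤ weilGroundEnergy a)
    {g : ℝ → ℂ} (hg : IsWeilTest g) (hsupp : tsupport g ⊆ Icc (-a) a) :
    L * ∫ t : ℝ, ‖g t‖ ^ 2 ≤ (weilQuadratic g).re := by
  rcases (integral_nonneg fun t ↦ by positivity : (0 : ℝ) ≤ ∫ t : ℝ, ‖g t‖ ^ 2).eq_or_lt with
    hz | hpos
  · have hg0 : g = 0 := hg.eq_zero_of_integral_norm_sq_eq_zero hz.symm
    rw [← hz, mul_zero, hg0, weilQuadratic_zero, Complex.zero_re]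
  · have := h.trans (weilGroundEnergy_le_div hg hsupp hpos)
    rwa [le_div_iff₀ hpos] at this

/-- **MAIN THEOREM (the exponential-slack Weil criterion).** If the ground energy of Weil's
quadratic functional on `[-a, a]` satisfies `ε(a) ≥ -C e^{κ a}` for all `a ≥ a₀` (`κ ≥ 0`), then
every non-trivial zero of `ζ` satisfies `|Re ρ - 1/2| ≤ κ/2`. [folklore] -/
theorem abs_re_sub_half_le_of_weilGroundEnergy_exp_lower {κ C a₀ : ℝ} (hκ : 0 ≤ κ)
    (H : ∀ a : ℝ, a₀ ≤ a → -(C * Real.exp (κ * a)) ≤ weilGroundEnergy a)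
    {ρ : ℂ} (hρ : ρ ∈ ZetaZeros.riemannZetaNontrivialZeros) : |ρ.re - 1 / 2| ≤ κ / 2 :=
  abs_re_sub_half_le_of_weilQuadratic_exp_lower hκ
    (fun a ha _ hg hs ↦ mul_integral_le_weilQuadratic_of_le_weilGroundEnergy (H a ha) hg hs) hρ

/-- **Zero-free half-plane from quasi-positivity**: `ε(a) ≥ -C e^{κ a}` for `a ≥ a₀` (`κ ≥ 0`)
implies `ζ(s) ≠ 0` for `Re s > (1 + κ)/2`. [folklore] -/
theorem riemannZeta_ne_zero_of_weilGroundEnergy_exp_lower {κ C a₀ : ℝ} (hκ : 0 ≤ κ)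
    (H : ∀ a : ℝ, a₀ ≤ a → -(C * Real.exp (κ * a)) ≤ weilGroundEnergy a)
    {s : ℂ} (hs : (1 + κ) / 2 < s.re) : riemannZeta s ≠ 0 := by
  intro hζ
  have hρ := ZetaZeros.riemannZetaNontrivialZeros.mem_of_re_pos hζ (by linarith)
  have h := (abs_le.1 (abs_re_sub_half_le_of_weilGroundEnergy_exp_lower hκ H hρ)).2
  linarith

/-- **RH from sub-exponential quasi-positivity of the ground energy**: if for every `κ > 0`
there are `C, a₀` with `ε(a) ≥ -C e^{κ a}` for all `a ≥ a₀`, then the Riemann hypothesis holds.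
[folklore] -/
theorem riemannHypothesis_of_weilGroundEnergy_subexp
    (H : ∀ κ : ℝ, 0 < κ → ∃ C a₀ : ℝ, ∀ a : ℝ, a₀ ≤ a → -(C * Real.exp (κ * a)) ≤ weilGroundEnergy a) :
    RiemannHypothesis := by
  refine riemannHypothesis_iff_strip_holds.2 fun s hs h0 h1 ↦ ?_
  have hρ := ZetaZeros.riemannZetaNontrivialZeros.mem_iff'.2 ⟨hs, h0, h1⟩
  have key : |s.re - 1 / 2| ≤ 0 := by
    refine le_of_forall_pos_le_add fun e he ↦ ?_
    obtain ⟨C, a₀, hC⟩ := H (2 * e) (by positivity)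
    have := abs_re_sub_half_le_of_weilGroundEnergy_exp_lower (by positivity) hC hρ
    linarith
  have := abs_nonpos_iff.1 key
  linarith

/-- **RH from sub-exponential quasi-positivity of Weil's functional on windows** (the same, with
the hypothesis on `Re W(g ⋆ g̃)` directly). [folklore] -/
theorem riemannHypothesis_of_weilQuadratic_subexp
    (H : ∀ κ : ℝ, 0 < κ → ∃ C a₀ : ℝ, ∀ a : ℝ, a₀ ≤ a → ∀ g : ℝ → ℂ, IsWeilTest g →
      tsupport g ⊆ Icc (-a) a → -(C * Real.exp (κ * a)) * ∫ t : ℝ, ‖g t‖ ^ 2 ≤ (weilQuadratic g).re) :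
    RiemannHypothesis := by
  refine riemannHypothesis_iff_strip_holds.2 fun s hs h0 h1 ↦ ?_
  have hρ := ZetaZeros.riemannZetaNontrivialZeros.mem_iff'.2 ⟨hs, h0, h1⟩
  have key : |s.re - 1 / 2| ≤ 0 := by
    refine le_of_forall_pos_le_add fun e he ↦ ?_
    obtain ⟨C, a₀, hC⟩ := H (2 * e) (by positivity)
    have := abs_re_sub_half_le_of_weilQuadratic_exp_lower (by positivity) hC hρ
    linarith
  have := abs_nonpos_iff.1 key
  linarith

/-- `RH → ε(a) ≥ 0` for `a > 0` (Yoshida's criterion in the tree,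
`riemannHypothesis_iff_forall_weilPositivityOn`, and `weilGroundEnergy_nonneg_iff_holds`).
[cite: Bombieri2000Weil, Thm. 2] -/
theorem weilGroundEnergy_nonneg_of_riemannHypothesis (hRH : RiemannHypothesis) {a : ℝ}
    (ha : 0 < a) : 0 ≤ weilGroundEnergy a :=
  (weilGroundEnergy_nonneg_iff_holds ha).2 (riemannHypothesis_iff_forall_weilPositivityOn.1 hRH a ha)

/-- **The exponential-slack Weil criterion, `iff` form.** The Riemann hypothesis holds if and
only if the ground energy of Weil's functional is not exponentially negative at any positive
rate: `RH ↔ ∀ κ > 0, ∃ C, ∀ a > 0, ε(a) ≥ -C e^{κ a}`. (`→`: `ε ≥ 0`, take `C = 0`; `←`: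
`riemannHypothesis_of_weilGroundEnergy_subexp`.) Compare Yoshida's criterion
`RH ↔ ∀ a > 0, ε(a) ≥ 0`. [folklore] -/
theorem riemannHypothesis_iff_weilGroundEnergy_subexp :
    RiemannHypothesis ↔
      ∀ κ : ℝ, 0 < κ → ∃ C : ℝ, ∀ a : ℝ, 0 < a → -(C * Real.exp (κ * a)) ≤ weilGroundEnergy a := by
  constructor
  · intro hRH κ _
    exact ⟨0, fun a ha ↦ by simpa using weilGroundEnergy_nonneg_of_riemannHypothesis hRH ha⟩
  · intro H
    refine riemannHypothesis_of_weilGroundEnergy_subexp fun κ hκ ↦ ?_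
    obtain ⟨C, hC⟩ := H κ hκ
    exact ⟨C, 1, fun a ha ↦ hC a (by linarith)⟩

/-- **`Ω`-theorem for the ground energy from an off-line zero.** If `ρ` is a non-trivial zero
and `0 ≤ κ < |2 Re ρ - 1|`, then for every `C` the inequality `ε(a) < -C e^{κ a}` holds for
arbitrarily large `a` (contrapositive of `abs_re_sub_half_le_of_weilGroundEnergy_exp_lower`).
[folklore] -/
theorem frequently_weilGroundEnergy_lt_of_offline_zero {ρ : ℂ}
    (hρ : ρ ∈ ZetaZeros.riemannZetaNontrivialZeros) {κ : ℝ} (hκ : 0 ≤ κ)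
    (hlt : κ / 2 < |ρ.re - 1 / 2|) (C : ℝ) :
    ∃ᶠ a in atTop, weilGroundEnergy a < -(C * Real.exp (κ * a)) := by
  rw [Filter.frequently_atTop]
  intro a₀
  by_contra h
  push Not at h
  exact absurd (abs_re_sub_half_le_of_weilGroundEnergy_exp_lower hκ h hρ) (not_le.2 hlt)

/-- **`Ω`-theorem, failure-of-RH form**: if the Riemann hypothesis fails then there is `κ > 0`
such that `ε(a) < -C e^{κ a}` for arbitrarily large `a`, for every `C`. [folklore] -/
theorem exists_frequently_weilGroundEnergy_lt_of_not_riemannHypothesis (h : ¬ RiemannHypothesis) :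
    ∃ κ : ℝ, 0 < κ ∧ ∀ C : ℝ, ∃ᶠ a in atTop, weilGroundEnergy a < -(C * Real.exp (κ * a)) := by
  by_contra H
  push Not at H
  refine h (riemannHypothesis_of_weilGroundEnergy_subexp fun κ hκ ↦ ?_)
  obtain ⟨C, hC⟩ := H κ hκ
  rw [Filter.eventually_atTop] at hC
  obtain ⟨a₀, ha₀⟩ := hC
  exact ⟨C, a₀, ha₀⟩

/-! ## The trivial floor `κ = 1`: the a-priori bound -/

/-- `∑_{n ≤ N} 1/√n ≤ 2√N` (with the `n = 0` term equal to `0`). [folklore] -/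
theorem sum_range_one_div_sqrt_le (N : ℕ) :
    ∑ n ∈ Finset.range (N + 1), 1 / Real.sqrt n ≤ 2 * Real.sqrt N := by
  induction N with
  | zero => simp
  | succ N ih =>
    rw [Finset.sum_range_succ]
    set s : ℝ := Real.sqrt ((N + 1 : ℕ) : ℝ) with hs
    set r : ℝ := Real.sqrt (N : ℝ) with hr
    have hs0 : 0 < s := Real.sqrt_pos.2 (by positivity)
    have hr0 : 0 ≤ r := Real.sqrt_nonneg _
    have hrs : r ≤ s := Real.sqrt_le_sqrt (by push_cast; linarith)
    have hprod : (s - r) * (s + r) = 1 := by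
      have h1 : s ^ 2 = (N : ℝ) + 1 := by rw [hs, Real.sq_sqrt (by positivity)]; push_cast; ring
      have h2 : r ^ 2 = (N : ℝ) := by rw [hr, Real.sq_sqrt (by positivity)]
      nlinarith [h1, h2]
    have key : 1 / s ≤ 2 * (s - r) := by
      rw [div_le_iff₀ hs0]
      nlinarith [hprod, hrs, hr0]
    linarith [ih, key]

/-- `∑_{n ≤ e^{2a}} Λ(n)/√n ≤ 4a·e^{a}` for `a > 0` (`Λ(n) ≤ log n ≤ 2a` and `∑ 1/√n ≤ 2√N`). [folklore] -/
theorem sum_vonMangoldt_div_sqrt_le {a : ℝ} (ha : 0 < a) :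
    ∑ n ∈ Finset.range (⌊Real.exp (2 * a)⌋₊ + 1), (Λ n : ℝ) / Real.sqrt n ≤
      4 * a * Real.exp a := by
  set N : ℕ := ⌊Real.exp (2 * a)⌋₊ with hN
  have hNle : (N : ℝ) ≤ Real.exp (2 * a) := Nat.floor_le (Real.exp_pos _).le
  have hterm : ∀ n ∈ Finset.range (N + 1), (Λ n : ℝ) / Real.sqrt n ≤ 2 * a * (1 / Real.sqrt n) := by
    intro n hn
    have hnN : n ≤ N := Nat.lt_succ_iff.1 (Finset.mem_range.1 hn)
    rcases Nat.eq_zero_or_pos n with rfl | hn0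
    · simp
    · have hlog : (Λ n : ℝ) ≤ 2 * a := by
        refine ArithmeticFunction.vonMangoldt_le_log.trans ?_
        have h1 : Real.log n ≤ Real.log N :=
          Real.log_le_log (by exact_mod_cast hn0) (by exact_mod_cast hnN)
        have h2 : Real.log N ≤ 2 * a := by
          have hN0 : (0 : ℝ) < N := by exact_mod_cast (lt_of_lt_of_le hn0 hnN)
          calc Real.log N ≤ Real.log (Real.exp (2 * a)) := Real.log_le_log hN0 hNle
            _ = 2 * a := Real.log_exp _
        linarith
      rw [div_eq_mul_one_div]
      exact mul_le_mul_of_nonneg_right hlog (by positivity)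
  have hsqrt : Real.sqrt N ≤ Real.exp a := by
    calc Real.sqrt N ≤ Real.sqrt (Real.exp (2 * a)) := Real.sqrt_le_sqrt hNle
      _ = Real.exp a := by
          rw [show Real.exp (2 * a) = Real.exp a ^ 2 by rw [← Real.exp_nat_mul]; ring_nf,
            Real.sqrt_sq (Real.exp_pos _).le]
  calc ∑ n ∈ Finset.range (N + 1), (Λ n : ℝ) / Real.sqrt n
      ≤ ∑ n ∈ Finset.range (N + 1), 2 * a * (1 / Real.sqrt n) := Finset.sum_le_sum hterm
    _ = 2 * a * ∑ n ∈ Finset.range (N + 1), 1 / Real.sqrt n := by rw [Finset.mul_sum]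
    _ ≤ 2 * a * (2 * Real.sqrt N) := by gcongr; exact sum_range_one_div_sqrt_le N
    _ ≤ 2 * a * (2 * Real.exp a) := by gcongr
    _ = 4 * a * Real.exp a := by ring

/-- **The trivial floor of the thermometer (`κ = 1`).** Unconditionally
`ε(a) ≥ −C (1 + a) e^{a}` for all `a > 0`: Bombieri's a-priori bound
`weilQuadratic_re_ge_of_tsupport_subset` with `∑_{n ≤ e^{2a}} Λ(n)/√n ≤ 4a e^{a}` and
`2 sinh a ≤ e^{a}`. So the hypothesis of `abs_re_sub_half_le_of_weilGroundEnergy_exp_lower` holds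
for free at every `κ > 1`, where its conclusion `|Re ρ − 1/2| ≤ κ/2` is empty of content.
[cite: Bombieri2000Weil, §4] -/
theorem weilGroundEnergy_ge_neg_exp :
    ∃ C : ℝ, 0 ≤ C ∧ ∀ a : ℝ, 0 < a → -(C * (1 + a) * Real.exp a) ≤ weilGroundEnergy a := by
  set c₀ : ℝ := (Complex.digamma (1 / 4)).re - Real.log π with hc₀
  refine ⟨max (1 + |c₀|) 8, le_max_of_le_right (by norm_num), fun a ha ↦ ?_⟩
  refine le_weilGroundEnergy_of_forall ha fun g hg hsupp hn ↦ ?_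
  have h := weilQuadratic_re_ge_of_tsupport_subset hg hsupp
  rw [hn, mul_one] at h
  have hS := sum_vonMangoldt_div_sqrt_le ha
  have hE := Real.exp_pos a
  have hsinh : 2 * (Real.sinh a - a) ≤ Real.exp a := by
    rw [Real.sinh_eq]
    have := Real.exp_pos (-a)
    linarith
  have hexp1 : 1 ≤ Real.exp a := Real.one_le_exp ha.le
  have hc : -|c₀| ≤ c₀ := neg_abs_le _
  have habs : 0 ≤ |c₀| := abs_nonneg _
  have hmax1 : 1 + |c₀| ≤ max (1 + |c₀|) 8 := le_max_left _ _
  have hmax2 : (8 : ℝ) ≤ max (1 + |c₀|) 8 := le_max_right _ _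
  have hA : (1 + |c₀| + 8 * a) * Real.exp a ≤ max (1 + |c₀|) 8 * (1 + a) * Real.exp a := by
    have h8 : 8 * a ≤ max (1 + |c₀|) 8 * a := mul_le_mul_of_nonneg_right hmax2 ha.le
    have : 1 + |c₀| + 8 * a ≤ max (1 + |c₀|) 8 * (1 + a) := by nlinarith
    exact mul_le_mul_of_nonneg_right this hE.le
  have hB : -((1 + |c₀| + 8 * a) * Real.exp a) ≤
      -(2 * (Real.sinh a - a))
        - 2 * (∑ n ∈ Finset.range (⌊Real.exp (2 * a)⌋₊ + 1), (Λ n : ℝ) / Real.sqrt n) + c₀ := by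
    have h1 : |c₀| * 1 ≤ |c₀| * Real.exp a := mul_le_mul_of_nonneg_left hexp1 habs
    nlinarith
  linarith

/-- The floor in the shape of the thermometer: `ε(a) ≥ −C_κ e^{κ a}` for every `κ > 1`. [folklore] -/
theorem weilGroundEnergy_exp_lower_of_one_lt {κ : ℝ} (hκ : 1 < κ) :
    ∃ C : ℝ, ∀ a : ℝ, 0 < a → -(C * Real.exp (κ * a)) ≤ weilGroundEnergy a := by
  obtain ⟨C, hC0, hC⟩ := weilGroundEnergy_ge_neg_exp
  refine ⟨C * (1 + 1 / (κ - 1)), fun a ha ↦ le_trans ?_ (hC a ha)⟩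
  have hδ : 0 < κ - 1 := sub_pos.2 hκ
  have hδ0 : κ - 1 ≠ 0 := hδ.ne'
  have hpos : 0 ≤ 1 + 1 / (κ - 1) := by positivity
  -- `1 + a ≤ (1 + 1/(κ-1)) e^{(κ-1) a}`
  have h1 : 1 + a ≤ (1 + 1 / (κ - 1)) * Real.exp ((κ - 1) * a) := by
    have hlin : (κ - 1) * a + 1 ≤ Real.exp ((κ - 1) * a) := Real.add_one_le_exp _
    have hda : 0 ≤ (κ - 1) * a := mul_nonneg hδ.le ha.le
    have hinv : 0 ≤ 1 / (κ - 1) := (one_div_pos.2 hδ).le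
    calc 1 + a ≤ (1 + 1 / (κ - 1)) * ((κ - 1) * a + 1) := by
          have e : (1 + 1 / (κ - 1)) * ((κ - 1) * a + 1) = 1 + a + (κ - 1) * a + 1 / (κ - 1) := by
            field_simp
            ring
          rw [e]
          linarith
      _ ≤ (1 + 1 / (κ - 1)) * Real.exp ((κ - 1) * a) := mul_le_mul_of_nonneg_left hlin hpos
  have h2 : C * (1 + a) * Real.exp a ≤ C * (1 + 1 / (κ - 1)) * Real.exp (κ * a) := by
    calc C * (1 + a) * Real.exp a
        ≤ C * ((1 + 1 / (κ - 1)) * Real.exp ((κ - 1) * a)) * Real.exp a := by gcongr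
      _ = C * (1 + 1 / (κ - 1)) * Real.exp (κ * a) := by
          rw [show κ * a = (κ - 1) * a + a by ring, Real.exp_add]; ring
  linarith

end Summit.RiemannHypothesis.RiemannHypothesis.Theorems
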